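import Summits.AtomisticToContinuum.Crystallization.Theorems.LayeredLawsSelectHcp.Negative.DiracLaws

/-!
# Negative knowledge for crux `LayeredLawsSelectHcp` (stmt-AtomisticToContinuum-9226), X:
# every ideal Barlow stacking is Barlow-like — the gap `(a, √2·a)` in its distance set

Part X (`--supports stmt-AtomisticToContinuum-9226`). `form_le_eighteen`: for a Hägg sequence and the
integer distance form `F` of `BarlowCoordination.twelve_mul_dist_barlowPos_sq` (`12·dist² = a²·F`), `F ≤ 18`
at two distinct index triples forces `F = 12`; `dist_eq_of_le_of_ideal`: in an ideal Barlow stacking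
(`h² = ⅔a²`) two distinct points at distance `≤ 5a/4` are at distance exactly `a` (so the crux's shell window
`5a/4` and bond window `28/25` both see exactly the touching pairs); **`barlowLike_barlowStacking_ideal`**:
every ideal Barlow stacking of spacing `a ∈ [9/10, 1]` — hcp, fcc, every polytype — satisfies the global
clause `BarlowLike` of the crux's H4, with `Φ = a • ·`. All `[folklore]`.
-/

noncomputable section

namespace Summit.AtomisticToContinuum.Crystallization.Theorems.LayeredLawsSelectHcp.Negative.IdealStackings

open MeasureTheory Set
open Literature.MathematicalPhysics.StatisticalMechanics Literature.Geometry.DiscreteGeometry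
open Summit.AtomisticToContinuum.Crystallization.Theses.PalmUnimodularRigidity (LayeredLawsSelectHcp)
open Summit.AtomisticToContinuum.Crystallization.Theorems.ChargedEnergyGapNegative
  (eStar eStar_le bddBelow_energyPerParticle_lennardJones)
open Summit.AtomisticToContinuum.Crystallization.Theorems.LayeredLawsSelectHcp.Negative.DiracLaws

/-- Euclidean `3`-space. [folklore] -/
local notation "E3" => EuclideanSpace ℝ (Fin 3)

/-! ## Every ideal Barlow stacking is Barlow-like; the gap `(a, √2·a)` in its distance set -/

section IdealStackings

variable {a h : ℝ} {s : ℤ → ℤ}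

/-- **No distances strictly between `a` and `5a/4` in an ideal Barlow stacking** (in fact none below
`√2·a`): in terms of the integer form `F` of `BarlowCoordination` (`12·dist² = a²·F`), `F ≤ 18` forces
`F = 0` or `F = 12`. [folklore] -/
theorem form_le_eighteen (hs : IsHaggSeq s) {k i j k' i' j' : ℤ}
    (hF : 3 * (2 * (i - i') + (j - j') + (haggLabel s k - haggLabel s k')) ^ 2 +
        (3 * (j - j') + (haggLabel s k - haggLabel s k')) ^ 2 + 8 * (k - k') ^ 2 ≤ 18)
    (hne : (k, i, j) ≠ (k', i', j')) :
    3 * (2 * (i - i') + (j - j') + (haggLabel s k - haggLabel s k')) ^ 2 +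
        (3 * (j - j') + (haggLabel s k - haggLabel s k')) ^ 2 + 8 * (k - k') ^ 2 = 12 := by
  set P := i - i' with hP
  set Q := j - j' with hQ
  set Λ := haggLabel s k - haggLabel s k' with hΛ
  have hK2 : (k - k') ^ 2 ≤ 2 := by nlinarith [sq_nonneg (2 * P + Q + Λ), sq_nonneg (3 * Q + Λ)]
  have hK : -1 ≤ k - k' ∧ k - k' ≤ 1 := by constructor <;> nlinarith
  rcases (show k' = k + 1 ∨ k' = k ∨ k' = k - 1 by omega) with hk' | hk' | hk'
  · -- adjacent layer above: Λ = -s k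
    have hΛ' : Λ = -s k := by rw [hΛ, hk', haggLabel_sub_haggLabel_succ]
    have hσ : -s k = 1 ∨ -s k = -1 := by rcases hs k with h1 | h1 <;> omega
    have e8 : 8 * (k - k') ^ 2 = 8 := by rw [hk']; ring
    rw [e8] at hF ⊢
    rw [hΛ'] at hF ⊢
    rcases hσ with hσ | hσ <;> rw [hσ] at hF ⊢
    · have hQb : -1 ≤ Q ∧ Q ≤ 1 := by constructor <;> nlinarith [sq_nonneg (2 * P + Q + 1)]
      have hPb : -2 ≤ P ∧ P ≤ 1 := by constructor <;> nlinarith [sq_nonneg (3 * Q + 1)]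
      obtain ⟨hQ1, hQ2⟩ := hQb
      obtain ⟨hP1, hP2⟩ := hPb
      interval_cases P <;> interval_cases Q <;> omega
    · have hQb : -1 ≤ Q ∧ Q ≤ 1 := by constructor <;> nlinarith [sq_nonneg (2 * P + Q + -1)]
      have hPb : -1 ≤ P ∧ P ≤ 2 := by constructor <;> nlinarith [sq_nonneg (3 * Q + -1)]
      obtain ⟨hQ1, hQ2⟩ := hQb
      obtain ⟨hP1, hP2⟩ := hPb
      interval_cases P <;> interval_cases Q <;> omega
  · -- same layer: Λ = 0, (P, Q) ≠ 0
    have hΛ0 : Λ = 0 := by rw [hΛ, hk', sub_self]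
    have hPQ : (P, Q) ≠ (0, 0) := by
      intro h0
      simp only [Prod.mk.injEq] at h0
      apply hne
      rw [hk']
      simp only [Prod.mk.injEq, true_and]
      constructor <;> omega
    have e8 : 8 * (k - k') ^ 2 = 0 := by rw [hk']; ring
    rw [e8, hΛ0] at hF ⊢
    have h12 := twelve_le_inLayer hPQ
    have hQb : -1 ≤ Q ∧ Q ≤ 1 := by constructor <;> nlinarith [sq_nonneg (2 * P + Q + 0)]
    have hPb : -2 ≤ P ∧ P ≤ 2 := by constructor <;> nlinarith [sq_nonneg (3 * Q + 0)]
    obtain ⟨hQ1, hQ2⟩ := hQb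
    obtain ⟨hP1, hP2⟩ := hPb
    interval_cases P <;> interval_cases Q <;> omega
  · -- adjacent layer below: Λ = s (k - 1)
    have hΛ' : Λ = s (k - 1) := by rw [hΛ, hk', haggLabel_sub_haggLabel_pred]
    have hσ : s (k - 1) = 1 ∨ s (k - 1) = -1 := hs (k - 1)
    have e8 : 8 * (k - k') ^ 2 = 8 := by rw [hk']; ring
    rw [e8] at hF ⊢
    rw [hΛ'] at hF ⊢
    rcases hσ with hσ | hσ <;> rw [hσ] at hF ⊢
    · have hQb : -1 ≤ Q ∧ Q ≤ 1 := by constructor <;> nlinarith [sq_nonneg (2 * P + Q + 1)]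
      have hPb : -2 ≤ P ∧ P ≤ 1 := by constructor <;> nlinarith [sq_nonneg (3 * Q + 1)]
      obtain ⟨hQ1, hQ2⟩ := hQb
      obtain ⟨hP1, hP2⟩ := hPb
      interval_cases P <;> interval_cases Q <;> omega
    · have hQb : -1 ≤ Q ∧ Q ≤ 1 := by constructor <;> nlinarith [sq_nonneg (2 * P + Q + -1)]
      have hPb : -1 ≤ P ∧ P ≤ 2 := by constructor <;> nlinarith [sq_nonneg (3 * Q + -1)]
      obtain ⟨hQ1, hQ2⟩ := hQb
      obtain ⟨hP1, hP2⟩ := hPb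
      interval_cases P <;> interval_cases Q <;> omega

/-- **Distance form of the gap**: in an ideal Barlow stacking (`a > 0`, `h² = ⅔a²`), two DISTINCT points
at distance `≤ 5a/4` are at distance exactly `a`. [folklore] -/
theorem dist_eq_of_le_of_ideal (hs : IsHaggSeq s) (ha : 0 < a) (hh : h ^ 2 = 2 / 3 * a ^ 2)
    {k i j k' i' j' : ℤ} (hne : (k, i, j) ≠ (k', i', j'))
    (hle : dist (barlowPos a h s k i j) (barlowPos a h s k' i' j') ≤ 5 / 4 * a) :
    dist (barlowPos a h s k i j) (barlowPos a h s k' i' j') = a := by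
  have h12 := twelve_mul_dist_barlowPos_sq hh s k i j k' i' j'
  set F : ℤ := 3 * (2 * (i - i') + (j - j') + (haggLabel s k - haggLabel s k')) ^ 2 +
    (3 * (j - j') + (haggLabel s k - haggLabel s k')) ^ 2 + 8 * (k - k') ^ 2 with hFdef
  have hd0 : 0 ≤ dist (barlowPos a h s k i j) (barlowPos a h s k' i' j') := dist_nonneg
  have hF : F ≤ 18 := by
    have h2 : dist (barlowPos a h s k i j) (barlowPos a h s k' i' j') ^ 2 ≤ (5 / 4 * a) ^ 2 :=
      pow_le_pow_left₀ hd0 hle 2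
    have h3 : (a ^ 2) * (F : ℝ) ≤ a ^ 2 * (75 / 4) := by nlinarith
    have h4 : (F : ℝ) ≤ 75 / 4 := le_of_mul_le_mul_left h3 (by positivity)
    have h5 : (F : ℝ) < 19 := by linarith
    have h6 : F < 19 := by exact_mod_cast h5
    omega
  have hF12 : F = 12 := form_le_eighteen hs hF hne
  exact (dist_barlowPos_eq_iff_form ha hh s k i j k' i' j').2 hF12

/-- Scaling the unit ideal stacking by `a` gives the ideal stacking of spacing `a`. [folklore] -/
theorem barlowPos_smul (a η : ℝ) (s : ℤ → ℤ) (k i j : ℤ) :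
    a • barlowPos 1 η s k i j = barlowPos a (a * η) s k i j := by
  ext l
  fin_cases l <;> simp <;> ring

/-- **Every ideal Barlow stacking of spacing `a ∈ [9/10, 1]` is Barlow-like** in the sense of the
crux: the scaling `z ↦ a • z` is a bijection from the unit stacking carrying unit contacts exactly
onto the pairs at distance in `(0, 28/25]` (both are the pairs with `F = 12`). In particular
`hcpStacking a (a√(2/3))`, `fccStacking a (a√(2/3))` and every ideal polytype satisfy H4's global
clause. [folklore] -/
theorem barlowLike_barlowStacking_ideal (hs : IsHaggSeq s) (h9 : 9 / 10 ≤ a) (h1 : a ≤ 1) :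
    BarlowLike (barlowStacking a (a * Real.sqrt (2 / 3)) s) := by
  have ha : 0 < a := by linarith
  have hη : (Real.sqrt (2 / 3)) ^ 2 = 2 / 3 * 1 ^ 2 := by rw [Real.sq_sqrt (by norm_num)]; ring
  have hη' : (a * Real.sqrt (2 / 3)) ^ 2 = 2 / 3 * a ^ 2 := by
    rw [mul_pow, Real.sq_sqrt (by norm_num)]; ring
  refine ⟨s, hs, fun z => a • z, ?_, ?_⟩
  · have himg : (fun z : E3 => a • z) '' barlowStacking 1 (Real.sqrt (2 / 3)) s =
        barlowStacking a (a * Real.sqrt (2 / 3)) s := by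
      ext z
      simp only [Set.mem_image, mem_barlowStacking_iff]
      constructor
      · rintro ⟨_, ⟨k, i, j, rfl⟩, rfl⟩
        exact ⟨k, i, j, barlowPos_smul a _ s k i j⟩
      · rintro ⟨k, i, j, rfl⟩
        exact ⟨_, ⟨k, i, j, rfl⟩, barlowPos_smul a _ s k i j⟩
    rw [← himg]
    exact Set.InjOn.bijOn_image (smul_right_injective E3 ha.ne').injOn
  · rintro _ ⟨k, i, j, rfl⟩ _ ⟨k', i', j', rfl⟩
    rw [dist_smul₀, Real.norm_of_nonneg ha.le]
    set d := dist (barlowPos 1 (Real.sqrt (2 / 3)) s k i j) (barlowPos 1 (Real.sqrt (2 / 3)) s k' i' j')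
      with hddef
    have hd0 : 0 ≤ d := dist_nonneg
    constructor
    · intro hd1
      rw [hd1, mul_one]
      exact ⟨ha, by linarith⟩
    · rintro ⟨hpos, hle⟩
      have hne : (k, i, j) ≠ (k', i', j') := by
        rintro heq
        simp only [Prod.mk.injEq] at heq
        obtain ⟨rfl, rfl, rfl⟩ := heq
        rw [hddef, dist_self, mul_zero] at hpos
        exact lt_irrefl 0 hpos
      have hle' : d ≤ 5 / 4 * 1 := by
        have : a * d ≤ a * (5 / 4) := by nlinarith
        have := le_of_mul_le_mul_left this ha
        linarith
      exact dist_eq_of_le_of_ideal hs one_pos hη hne hle'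

end IdealStackings

end Summit.AtomisticToContinuum.Crystallization.Theorems.LayeredLawsSelectHcp.Negative.IdealStackings

end
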